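import Mathlib
import HarnessLib
import Summits.QuantumAdvantage.QuantumAdvantage.Theorems.FibreDialA
import Literature.Computability.MetaComplexity.LowDegreeClosure

set_option linter.dupNamespace false
set_option autoImplicit false

/-!
# FibreDial (B) — row `d = 0` of the window-fibre dial, decided (cell decomp-qadv, lens 4, g18 §6 / K5)

Prop-definition-free tree twin of §6 of the lens-4 g18 node `FibreDial` (after part A `FibreDialA`; supports of item
stmt-QuantumAdvantage-28489).  For the u-walk family `ringWinU` on `k + m` bits (prefix `a` ++ window `w`), arbitrary
prime `p`:
* `const_of_hasDegF_zero` — a cut of `𝔽_p`-degree `0` is constant (`Smolensky.eq_const_of_mem_lowDeg_zero`).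
* `not_win_both` (one-cut parity flip) and the SWAP LAW `swap_law` for constant strategies winning on a whole fibre.
* `fibreLoss_of_degZero` — for `m ≥ 3` every constant-cut strategy LOSES on every window fibre `a ++ {0,1}^m`, every
  `k`, every charge; hence `two_pow_le_losers_of_const`: `≥ 2^k` losses on `k + 3` bits (rate 1 : 1, no absorption).
* `fibrePerfect_degZero_one/_two` — the dead positions `m = 1, 2` (`decide`d perfect tiny strategies, planted by part A).
0 sorry; axioms standard; no `instance`, no `notation`, no `native_decide`; no `def … : Prop`.
-/

open Finset
open Literature.Computability.MetaComplexity Literature.Computability.MetaComplexity.Smolensky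
open Summit.QuantumAdvantage.AdviceFreeQNC0

namespace Summit.QuantumAdvantage.QuantumAdvantage.Theorems.FibreDial

variable {p : ℕ} [Fact p.Prime]

section RowZero
variable {k m : ℕ}

/-- a cut function of `𝔽_p`-degree `0` is constant. -/
theorem const_of_hasDegF_zero {n : ℕ} {f : (Fin n → Bool) → Bool} (hf : HasDegF p f 0) (u v : Fin n → Bool) :
    f u = f v := by
  haveI : Fact (1 < p) := ⟨(Fact.out : p.Prime).one_lt⟩
  have h := congrFun (Smolensky.eq_const_of_mem_lowDeg_zero (F := ZMod p) hf v) u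
  simp only [Pi.smul_apply, Pi.one_apply, smul_eq_mul, mul_one] at h
  revert h
  cases f u <;> cases f v <;> simp

/-- the window input `e_i`. -/
def unitW (m i : ℕ) : Fin m → Bool := fun j => decide (j.val = i)

/-- the window input `e_i + e_l`. -/
def pairW (m i l : ℕ) : Fin m → Bool := fun j => decide (j.val = i ∨ j.val = l)

/-- `#{x < j : x = i} = [i < j]` inside `Fin m` (`i < m`). -/
theorem card_filter_lt_eq {i : ℕ} (hi : i < m) (j : ℕ) :
    (univ.filter fun x : Fin m => x.val < j ∧ x.val = i).card = if i < j then 1 else 0 := by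
  by_cases hij : i < j
  · rw [if_pos hij, card_eq_one]
    refine ⟨⟨i, hi⟩, ?_⟩
    ext x
    simp only [mem_filter, mem_univ, true_and, mem_singleton, Fin.ext_iff]
    constructor
    · rintro ⟨-, h⟩; exact h
    · intro h; exact ⟨by omega, h⟩
  · rw [if_neg hij, card_eq_zero, filter_eq_empty_iff]
    rintro x - ⟨hx, hxi⟩
    omega

/-- FibreDialB helper `wt_unitW` (decomp-qadv land package; see the module docstring). -/
theorem wt_unitW {i : ℕ} (hi : i < m) : wt (unitW m i) = 1 := by
  unfold wt unitW
  rw [card_eq_one]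
  exact ⟨⟨i, hi⟩, by ext j; simp [Fin.ext_iff]⟩

/-- FibreDialB helper `wtPrefix_unitW` (decomp-qadv land package; see the module docstring). -/
theorem wtPrefix_unitW {i : ℕ} (hi : i < m) (j : ℕ) : wtPrefix (unitW m i) j = if i < j then 1 else 0 := by
  unfold wtPrefix unitW
  simp_rw [decide_eq_true_eq]
  exact card_filter_lt_eq hi j

/-- FibreDialB helper `wt_pairW` (decomp-qadv land package; see the module docstring). -/
theorem wt_pairW {i l : ℕ} (hi : i < m) (hl : l < m) (hil : i ≠ l) : wt (pairW m i l) = 2 := by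
  unfold wt pairW
  have e : (univ.filter fun j : Fin m => decide (j.val = i ∨ j.val = l) = true) =
      {(⟨i, hi⟩ : Fin m), ⟨l, hl⟩} := by
    ext j; simp [Fin.ext_iff]
  rw [e, card_pair (Fin.ne_of_val_ne hil)]

/-- FibreDialB helper `wtPrefix_pairW` (decomp-qadv land package; see the module docstring). -/
theorem wtPrefix_pairW {i l : ℕ} (hi : i < m) (hl : l < m) (hil : i ≠ l) (j : ℕ) :
    wtPrefix (pairW m i l) j = (if i < j then 1 else 0) + (if l < j then 1 else 0) := by
  unfold wtPrefix pairW
  have e : (univ.filter fun x : Fin m => x.val < j ∧ decide (x.val = i ∨ x.val = l) = true) =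
      (univ.filter fun x : Fin m => x.val < j ∧ x.val = i) ∪ (univ.filter fun x : Fin m => x.val < j ∧ x.val = l) := by
    ext x
    simp only [mem_filter, mem_univ, true_and, decide_eq_true_eq, mem_union]
    tauto
  rw [e, card_union_of_disjoint (disjoint_filter.2 fun x _ h1 h2 => hil (h1.2.symm.trans h2.2)),
    card_filter_lt_eq hi, card_filter_lt_eq hl]

/-- walk exponents on the PHANTOM cuts (`g ≤ k`) of a fibre: `|a| + |w| + W_g(a)` — they see the window only
through its weight. -/
theorem walkExp_append_prefix (a : Fin k → Bool) (w : Fin m → Bool) {g : ℕ} (hg : g ≤ k) :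
    walkExp (Fin.append a w) g = wt a + wt w + wtPrefix a g := by
  unfold walkExp
  rw [wt_append, wtPrefix_append_of_le a w hg]

/-- the LAST cut sees `2|a| + 2|w|`. -/
theorem walkExp_append_last (a : Fin k → Bool) (w : Fin m → Bool) :
    walkExp (Fin.append a w) (k + m) = 2 * wt a + 2 * wt w := by
  rw [walkExp_append_window]
  unfold walkExp
  rw [wtPrefix_full w]
  ring

/-- **PARITY FLIP**: if the fired-and-live sets at two inputs differ by exactly one cut, the strategy does not win
at both. -/
theorem not_win_both {n : ℕ} (c : ℕ) (y : Fin (n + 1) → (Fin n → Bool) → Bool) (u u' : Fin n → Bool)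
    (g₀ : Fin (n + 1))
    (hagree : ∀ g : Fin (n + 1), g ≠ g₀ →
      ((y g u = true ∧ (c + g.val + walkExp u g.val) % 3 ≠ 0) ↔
        (y g u' = true ∧ (c + g.val + walkExp u' g.val) % 3 ≠ 0)))
    (h₀ : y g₀ u = true ∧ (c + g₀.val + walkExp u g₀.val) % 3 ≠ 0)
    (h₀' : ¬ (y g₀ u' = true ∧ (c + g₀.val + walkExp u' g₀.val) % 3 ≠ 0))
    (hw : ringWinU c y u = true) (hw' : ringWinU c y u' = true) : False := by
  classical
  unfold ringWinU at hw hw'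
  rw [decide_eq_true_eq] at hw hw'
  have hset : (univ.filter fun g : Fin (n + 1) => y g u = true ∧ (c + g.val + walkExp u g.val) % 3 ≠ 0) =
      insert g₀ (univ.filter fun g : Fin (n + 1) => y g u' = true ∧ (c + g.val + walkExp u' g.val) % 3 ≠ 0) := by
    ext g
    simp only [mem_filter, mem_univ, true_and, mem_insert]
    by_cases hg : g = g₀
    · subst hg; exact ⟨fun _ => Or.inl rfl, fun _ => h₀⟩
    · rw [hagree g hg]; exact ⟨fun h => Or.inr h, fun h => h.resolve_left hg⟩
  rw [hset, card_insert_of_notMem (by simpa only [mem_filter, mem_univ, true_and] using h₀')] at hw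
  omega

/-- **THE SWAP LAW** (constant strategy `y` winning on the whole fibre over `a`): if the window inputs `w, w'` have
the same weight and the same prefix weights except `W_j(w') = W_j(w) + 1` at one window cut `j`, and cut `k + j`
FIRES, then its label at `a ++ w` is `≡ 1 (mod 3)` (else exactly one of the two labels is dead: parity flip). -/
theorem swap_law (c : ℕ) (y : Fin (k + m + 1) → (Fin (k + m) → Bool) → Bool)
    (hc : ∀ g (u v : Fin (k + m) → Bool), y g u = y g v)
    (a : Fin k → Bool) (hwin : ∀ w : Fin m → Bool, ringWinU c y (Fin.append a w) = true)
    {j : ℕ} (hj : k + j < k + m + 1) (hfire : ∀ u, y ⟨k + j, hj⟩ u = true)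
    (w w' : Fin m → Bool) (hwt : wt w' = wt w) (hpre : ∀ j', j' ≠ j → wtPrefix w' j' = wtPrefix w j')
    (hjump : wtPrefix w' j = wtPrefix w j + 1) :
    (c + (k + j) + 2 * wt a + wt w + wtPrefix w j) % 3 = 1 := by
  have hL : c + (k + j) + walkExp (Fin.append a w) (k + j) = c + (k + j) + 2 * wt a + wt w + wtPrefix w j := by
    rw [walkExp_append_window]; unfold walkExp; ring
  have hL' : c + (k + j) + walkExp (Fin.append a w') (k + j) =
      c + (k + j) + 2 * wt a + wt w + wtPrefix w j + 1 := by
    rw [walkExp_append_window]; unfold walkExp; rw [hwt, hjump]; ring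
  -- labels agree at every other cut
  have hagree : ∀ g : Fin (k + m + 1), g ≠ ⟨k + j, hj⟩ →
      ((y g (Fin.append a w) = true ∧ (c + g.val + walkExp (Fin.append a w) g.val) % 3 ≠ 0) ↔
        (y g (Fin.append a w') = true ∧ (c + g.val + walkExp (Fin.append a w') g.val) % 3 ≠ 0)) := by
    intro g hg
    have hE : walkExp (Fin.append a w) g.val = walkExp (Fin.append a w') g.val := by
      rcases Nat.lt_or_ge k g.val with hgk | hgk
      · obtain ⟨j', hj'⟩ : ∃ j', g.val = k + j' := ⟨g.val - k, by omega⟩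
        have hne : j' ≠ j := fun h => hg (Fin.ext (by rw [hj', h]))
        rw [hj', walkExp_append_window, walkExp_append_window]
        unfold walkExp
        rw [hwt, hpre j' hne]
      · rw [walkExp_append_prefix a w hgk, walkExp_append_prefix a w' hgk, hwt]
    rw [hc g (Fin.append a w) (Fin.append a w'), hE]
  have hmod : (c + (k + j) + 2 * wt a + wt w + wtPrefix w j) % 3 < 3 := Nat.mod_lt _ (by norm_num)
  by_contra hne1
  rcases Nat.lt_or_ge ((c + (k + j) + 2 * wt a + wt w + wtPrefix w j) % 3) 1 with h0 | h1
  · -- label at w is dead (≡ 0), at w' live (≡ 1): flip with the roles swapped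
    refine not_win_both c y (Fin.append a w') (Fin.append a w) ⟨k + j, hj⟩
      (fun g hg => (hagree g hg).symm) ⟨hfire _, ?_⟩ ?_ (hwin w') (hwin w)
    · show (c + (k + j) + walkExp (Fin.append a w') (k + j)) % 3 ≠ 0
      rw [hL']; omega
    · show ¬ (y ⟨k + j, hj⟩ (Fin.append a w) = true ∧ (c + (k + j) + walkExp (Fin.append a w) (k + j)) % 3 ≠ 0)
      rw [hL]; omega
  · -- label ≡ 2 at w (live), ≡ 0 at w' (dead)
    refine not_win_both c y (Fin.append a w) (Fin.append a w') ⟨k + j, hj⟩ hagree ⟨hfire _, ?_⟩ ?_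
      (hwin w) (hwin w')
    · show (c + (k + j) + walkExp (Fin.append a w) (k + j)) % 3 ≠ 0
      rw [hL]; omega
    · show ¬ (y ⟨k + j, hj⟩ (Fin.append a w') = true ∧ (c + (k + j) + walkExp (Fin.append a w') (k + j)) % 3 ≠ 0)
      rw [hL']; omega

/-- three consecutive (or `2`-stepped) residues mod `3` contain exactly one zero. -/
theorem live_three (θ : ℕ) :
    ((if (θ + 0) % 3 ≠ 0 then 1 else 0) + (if (θ + 1) % 3 ≠ 0 then 1 else 0) +
      (if (θ + 2) % 3 ≠ 0 then 1 else 0) : ℕ) = 2 := by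
  split_ifs <;> omega

/-- FibreDialB helper `live_three'` (decomp-qadv land package; see the module docstring). -/
theorem live_three' (θ : ℕ) :
    ((if (θ + 2 * 0) % 3 ≠ 0 then 1 else 0) + (if (θ + 2 * 1) % 3 ≠ 0 then 1 else 0) +
      (if (θ + 2 * 2) % 3 ≠ 0 then 1 else 0) : ℕ) = 2 := by
  split_ifs <;> omega

/-- **(K5) ROW `d = 0` IS LIVE FROM `m = 3` ON, AT EVERY CO-DIMENSION `k`**: a constant-cut strategy (cut degree
`0`) is never perfect on a prefix-frozen window fibre `a ++ {0,1}^m` of dimension `m ≥ 3` — for every prime `p`, every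
charge, and in spite of the `k` phantom cuts.  Proof: by the swap law every interior window cut `k + j` (`1 ≤ j ≤ m − 1`)
is SILENT (test inputs `e_j / e_{j−1}` force its base label `≡ 0`, then `e_j + e_l / e_{j−1} + e_l` contradict it); the
remaining cuts see the window only through `|w|` resp. `2|w|`, so over the inputs `0, e_0, e_0 + e_1` each fired cut is
live exactly twice — an even total — while three wins need an odd total. -/
theorem fibreLoss_of_degZero (hm : 3 ≤ m) (c : ℕ) (y : Fin (k + m + 1) → (Fin (k + m) → Bool) → Bool)
    (hy : ∀ g, HasDegF p (y g) 0) (a : Fin k → Bool) : ∃ w : Fin m → Bool, ringWinU c y (Fin.append a w) = false := by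
  classical
  by_contra hne
  push Not at hne
  have hwin : ∀ w : Fin m → Bool, ringWinU c y (Fin.append a w) = true := fun w => by simpa using hne w
  have hc : ∀ g (u v : Fin (k + m) → Bool), y g u = y g v := fun g u v => const_of_hasDegF_zero (hy g) u v
  -- Step 1: the interior window cuts are silent
  have silent : ∀ j, 1 ≤ j → j < m → ∀ (hj : k + j < k + m + 1) (u), y ⟨k + j, hj⟩ u = false := by
    intro j hj1 hjm hj u
    by_contra hf
    rw [Bool.not_eq_false] at hf
    have hfire : ∀ v, y ⟨k + j, hj⟩ v = true := fun v => by rw [hc _ v u]; exact hf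
    -- test pair 1: e_j vs e_{j-1}
    have h1 := swap_law c y hc a hwin hj hfire (unitW m j) (unitW m (j - 1))
      (by rw [wt_unitW (by omega), wt_unitW (by omega)])
      (fun j' hj' => by rw [wtPrefix_unitW (by omega), wtPrefix_unitW (by omega)]; split_ifs <;> omega)
      (by rw [wtPrefix_unitW (by omega), wtPrefix_unitW (by omega)]; split_ifs <;> omega)
    rw [wt_unitW (by omega), wtPrefix_unitW (by omega), if_neg (lt_irrefl j)] at h1
    -- test pair 2: e_j + e_l vs e_{j-1} + e_l with l ∉ {j-1, j}
    obtain ⟨l, hlm, hlj, hlj'⟩ : ∃ l, l < m ∧ l ≠ j ∧ l ≠ j - 1 := by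
      by_cases hj2 : j = 1
      · exact ⟨2, by omega, by omega, by omega⟩
      · exact ⟨0, by omega, by omega, by omega⟩
    have h2 := swap_law c y hc a hwin hj hfire (pairW m j l) (pairW m (j - 1) l)
      (by rw [wt_pairW (by omega) hlm (Ne.symm hlj'), wt_pairW (by omega) hlm (Ne.symm hlj)])
      (fun j' hj' => by
        rw [wtPrefix_pairW (by omega) hlm (Ne.symm hlj'), wtPrefix_pairW (by omega) hlm (Ne.symm hlj)]
        split_ifs <;> omega)
      (by rw [wtPrefix_pairW (by omega) hlm (Ne.symm hlj'), wtPrefix_pairW (by omega) hlm (Ne.symm hlj)]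
          split_ifs <;> omega)
    rw [wt_pairW (by omega) hlm (Ne.symm hlj), wtPrefix_pairW (by omega) hlm (Ne.symm hlj), if_neg (lt_irrefl j)] at h2
    split_ifs at h2 <;> omega
  -- Step 2: parity over the weights 0, 1, 2
  have hm1 : 0 < m := by omega
  have hm2 : 1 < m := by omega
  set u₀ : Fin (k + m) → Bool := Fin.append a (fun _ => false) with hu₀
  set Fired : Finset (Fin (k + m + 1)) := univ.filter fun g => y g u₀ = true with hFired
  have hN : ∀ w : Fin m → Bool,
      (∑ g ∈ Fired, if (c + g.val + walkExp (Fin.append a w) g.val) % 3 ≠ 0 then 1 else 0) % 2 = 1 := by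
    intro w
    have hw := hwin w
    unfold ringWinU at hw
    rw [decide_eq_true_eq] at hw
    have e : (univ.filter fun g : Fin (k + m + 1) =>
        y g (Fin.append a w) = true ∧ (c + g.val + walkExp (Fin.append a w) g.val) % 3 ≠ 0) =
        Fired.filter fun g => (c + g.val + walkExp (Fin.append a w) g.val) % 3 ≠ 0 := by
      ext g
      simp only [hFired, mem_filter, mem_univ, true_and]
      rw [hc g (Fin.append a w) u₀]
    rwa [e, card_filter] at hw
  have hsupp : ∀ g ∈ Fired, g.val ≤ k ∨ g.val = k + m := by
    intro g hg
    rw [hFired, mem_filter] at hg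
    by_contra hbad
    push Not at hbad
    have hs := silent (g.val - k) (by omega) (by omega) (by omega) u₀
    have eg : (⟨k + (g.val - k), by omega⟩ : Fin (k + m + 1)) = g := Fin.ext (by simp; omega)
    rw [eg] at hs
    rw [hs] at hg
    exact Bool.noConfusion hg.2
  have h0 := hN (fun _ : Fin m => false)
  have h1 := hN (unitW m 0)
  have h2 := hN (pairW m 0 1)
  have hw0 : wt (fun _ : Fin m => false) = 0 := by simp [wt]
  have hsum : (∑ g ∈ Fired, if (c + g.val + walkExp (Fin.append a fun _ : Fin m => false) g.val) % 3 ≠ 0 then 1 else 0) +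
      (∑ g ∈ Fired, if (c + g.val + walkExp (Fin.append a (unitW m 0)) g.val) % 3 ≠ 0 then 1 else 0) +
      (∑ g ∈ Fired, if (c + g.val + walkExp (Fin.append a (pairW m 0 1)) g.val) % 3 ≠ 0 then 1 else 0) =
      Fired.card * 2 := by
    rw [← sum_add_distrib, ← sum_add_distrib]
    rw [show Fired.card * 2 = ∑ g ∈ Fired, 2 by rw [sum_const, smul_eq_mul]]
    refine sum_congr rfl fun g hg => ?_
    rcases hsupp g hg with hgk | hgm
    · rw [walkExp_append_prefix a _ hgk, walkExp_append_prefix a _ hgk, walkExp_append_prefix a _ hgk, hw0,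
        wt_unitW hm1, wt_pairW hm1 hm2 (by norm_num)]
      have := live_three (c + g.val + wt a + wtPrefix a g.val)
      convert this using 4 <;> ring_nf
    · rw [hgm, walkExp_append_last, walkExp_append_last, walkExp_append_last, hw0, wt_unitW hm1,
        wt_pairW hm1 hm2 (by norm_num)]
      have := live_three' (c + (k + m) + 2 * wt a)
      convert this using 4 <;> ring_nf
  omega

/-- **(K5) consequently: every constant-cut strategy on `k + 3` bits has `≥ 2^k` losses, at every charge and every
prime — an absorption-free floor at exchange rate 1 : 1.** -/
theorem two_pow_le_losers_of_const (k c : ℕ) (y : Fin (k + 3 + 1) → (Fin (k + 3) → Bool) → Bool)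
    (hy : ∀ g, HasDegF p (y g) 0) :
    2 ^ k ≤ (univ.filter fun u : Fin (k + 3) → Bool => ringWinU c y u = false).card :=
  two_pow_le_losers_of_fibreLoss c y (fibreLoss_of_degZero le_rfl c y hy)

/-- the 1-bit game has a perfect constant strategy (charge `1`, fire cut `0`), so row `d = 0` is DEAD at `m = 1`:
planted on the window it wins on the whole fibre `0^k ++ {0,1}` (charge `1 + 2k`). -/
theorem fibrePerfect_degZero_one (k : ℕ) :
    (∀ g, HasDegF p (plant k (fun j (_ : Fin 1 → Bool) => decide (j.val = 0)) g) 0) ∧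
      ∀ w : Fin 1 → Bool, ringWinU (1 + 2 * k) (plant k fun j (_ : Fin 1 → Bool) => decide (j.val = 0))
        (Fin.append (fun _ : Fin k => false) w) = true :=
  fibrePerfect_of_perfect 1 _ (fun j => RigidityLaws.hasDegF_const p _ 0) (by decide)

/-- the 2-bit game has a perfect constant strategy (charge `2`, fire cuts `0, 1`), so row `d = 0` is DEAD at `m = 2`. -/
theorem fibrePerfect_degZero_two (k : ℕ) :
    (∀ g, HasDegF p (plant k (fun j (_ : Fin 2 → Bool) => decide (j.val ≤ 1)) g) 0) ∧
      ∀ w : Fin 2 → Bool, ringWinU (2 + 2 * k) (plant k fun j (_ : Fin 2 → Bool) => decide (j.val ≤ 1))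
        (Fin.append (fun _ : Fin k => false) w) = true :=
  fibrePerfect_of_perfect 2 _ (fun j => RigidityLaws.hasDegF_const p _ 0) (by decide)

end RowZero

end Summit.QuantumAdvantage.QuantumAdvantage.Theorems.FibreDial
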